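import Mathlib.GroupTheory.PGroup
import Mathlib.GroupTheory.SpecificGroups.Cyclic
import Mathlib.Algebra.Order.BigOperators.Group.Finset
import HarnessLib

/-!
# Two lemmas on finite commutative `p`-groups: "`#{x : x^p = 1} ≤ p` ⇒ cyclic" and generator transfer along surjections

Route-independent `Theorems` file (cell `b2b-bsdres`, seat `b2b-bsdres-x10b`, gen 44), part 4 of the series «tower square root»
serving crux `DerivedHeightCap` (stmt-BirchSwinnertonDyer-18438, route DefiniteTheta), registered stub `stub_towerSqrt`.
HONEST FRAMING: no curve asserted, no class closed, BSD not proved by any of this.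

Pure group theory used in part 5 to show that the anticyclotomic layer groups `G_n^{ac} = Pic(𝒪_{p^n})/Δ` are CYCLIC with
coherent generators:

* §1 `card_filter_pow_prime_pow_eq_one_le`: in a commutative group with `#{x : x^p = 1} ≤ p`, `#{x : x^{p^v} = 1} ≤ p^v`
  (the `p`-th power map has fibres of size `≤ p`); hence `isCyclic_of_isPGroup_of_card_le`: a finite commutative `p`-group with at
  most `p` elements killed by `p` is cyclic (Mathlib's `isCyclic_of_card_pow_eq_one_le`).
* §2 `not_generator_pow_prime`: in a non-trivial commutative `p`-group no `p`-th power is a generator; hence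
  `forall_exists_pow_eq_of_map` (generator transfer): if `G` is a cyclic `p`-group and the image of `c ∈ G` under a homomorphism
  onto... (any homomorphism to) a NON-TRIVIAL `p`-group `H` generates `H`, then `c` generates `G`.

## References
* [Washington1997] §13.2 (structure of `ℤ_p`-extensions: the layers are cyclic); folklore group theory.
-/

open scoped BigOperators

-- D-0017: single-problem summit, the namespace repeats the problem name by design.
set_option linter.dupNamespace false

namespace Summit.BirchSwinnertonDyer.BirchSwinnertonDyer.Theorems.TowerSqrt

variable {p : ℕ} [hp : Fact p.Prime] {G : Type*} [CommGroup G]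

/-! ### §1 `#{x : x^p = 1} ≤ p` forces cyclicity of a finite commutative `p`-group -/

omit hp in
/-- **Fibre count**: if at most `p` elements are killed by `p`, then at most `p^v` elements are killed by `p^v` (induction on
`v`: `x ↦ x^p` maps `G[p^{v+1}]` to `G[p^v]` with fibres inside cosets of `G[p]`). [folklore] -/
theorem card_filter_pow_prime_pow_eq_one_le [Fintype G] [DecidableEq G]
    (h : (Finset.univ.filter fun x : G => x ^ p = 1).card ≤ p) (v : ℕ) :
    (Finset.univ.filter fun x : G => x ^ p ^ v = 1).card ≤ p ^ v := by
  induction v with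
  | zero =>
    have : (Finset.univ.filter fun x : G => x ^ p ^ 0 = 1) = {1} := by
      ext x; simp
    rw [this, Finset.card_singleton, pow_zero]
  | succ v ih =>
    set S := Finset.univ.filter fun x : G => x ^ p ^ (v + 1) = 1 with hS
    set T := Finset.univ.filter fun x : G => x ^ p ^ v = 1 with hT
    -- x ↦ x^p maps S to T
    have himg : S.image (fun x : G => x ^ p) ⊆ T := by
      intro y hy
      obtain ⟨x, hx, rfl⟩ := Finset.mem_image.mp hy
      rw [hS, Finset.mem_filter] at hx
      rw [hT, Finset.mem_filter, ← pow_mul, ← pow_succ']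
      exact ⟨Finset.mem_univ _, hx.2⟩
    -- fibres have at most p elements
    have hfib : ∀ b ∈ S.image (fun x : G => x ^ p), (S.filter fun a => a ^ p = b).card ≤ p := by
      intro b hb
      obtain ⟨a₀, -, ha₀⟩ := Finset.mem_image.mp hb
      refine le_trans ?_ h
      refine Finset.card_le_card_of_injOn (fun a => a * a₀⁻¹) (fun a ha => ?_) (fun a₁ _ a₂ _ h12 => ?_)
      · rw [Finset.mem_coe, Finset.mem_filter] at ha
        rw [Finset.mem_coe, Finset.mem_filter, mul_pow, inv_pow, ha.2, ha₀, mul_inv_cancel]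
        exact ⟨Finset.mem_univ _, rfl⟩
      · exact mul_right_cancel h12
    calc S.card ≤ p * (S.image fun x : G => x ^ p).card := Finset.card_le_mul_card_image S p hfib
      _ ≤ p * T.card := Nat.mul_le_mul_left p (Finset.card_le_card himg)
      _ ≤ p * p ^ v := Nat.mul_le_mul_left p ih
      _ = p ^ (v + 1) := (pow_succ' p v).symm

/-- **A finite commutative `p`-group with at most `p` elements killed by `p` is cyclic** (for every `n > 0` the elements killed by
`n` are those killed by `gcd(n, #G) = p^v ≤ n`, at most `p^v` of them; Mathlib `isCyclic_of_card_pow_eq_one_le`). [folklore] -/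
theorem isCyclic_of_isPGroup_of_card_le [Fintype G] [DecidableEq G] (hG : IsPGroup p G)
    (h : (Finset.univ.filter fun x : G => x ^ p = 1).card ≤ p) : IsCyclic G := by
  obtain ⟨m, hm⟩ := (IsPGroup.iff_card).mp hG
  refine isCyclic_of_card_pow_eq_one_le fun n hn => ?_
  -- gcd n (p^m) = p^v
  obtain ⟨v, -, hv⟩ := (Nat.dvd_prime_pow hp.out).mp (Nat.gcd_dvd_right n (p ^ m))
  have hset : (Finset.univ.filter fun a : G => a ^ n = 1) = Finset.univ.filter fun a : G => a ^ p ^ v = 1 := by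
    ext a
    simp only [Finset.mem_filter, Finset.mem_univ, true_and]
    have hcard : a ^ p ^ m = 1 := by rw [← hm]; exact pow_card_eq_one'
    constructor
    · intro ha
      rw [← hv]
      exact pow_gcd_eq_one.mpr ⟨ha, hcard⟩
    · intro ha
      obtain ⟨c, hc⟩ := Nat.gcd_dvd_left n (p ^ m)
      rw [hc, pow_mul, hv, ha, one_pow]
  rw [hset]
  refine (card_filter_pow_prime_pow_eq_one_le h v).trans ?_
  rw [← hv]
  exact Nat.le_of_dvd hn (Nat.gcd_dvd_left n (p ^ m))

/-! ### §2 Generator transfer in cyclic `p`-groups -/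

/-- **No `p`-th power generates a non-trivial commutative `p`-group.** [folklore] -/
theorem not_generator_pow_prime {H : Type*} [CommGroup H] (hH : IsPGroup p H) {y : H} (hy : y ≠ 1) (z : H)
    (hgen : ∀ x : H, ∃ k : ℕ, (z ^ p) ^ k = x) : False := by
  obtain ⟨k, hk⟩ := hgen z
  obtain ⟨j, hj⟩ := hH z
  -- z^{pk} = z, so z^{pk - 1} = 1 and ord z ∣ pk - 1; ord z = p^i forces z = 1
  have hz1 : z ^ (p * k - 1) = 1 := by
    rcases Nat.eq_zero_or_pos k with rfl | hkpos
    · rw [pow_zero] at hk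
      rw [← hk, one_pow]
    · have h1 : 1 ≤ p * k := Nat.one_le_iff_ne_zero.mpr (Nat.mul_ne_zero hp.out.ne_zero hkpos.ne')
      have : z ^ (p * k - 1) * z = z := by
        rw [← pow_succ, Nat.sub_add_cancel h1, pow_mul, hk]
      simpa using this
  have hord : orderOf z ∣ p * k - 1 := orderOf_dvd_of_pow_eq_one hz1
  have hordp : orderOf z ∣ p ^ j := orderOf_dvd_of_pow_eq_one hj
  obtain ⟨i, -, hi⟩ := (Nat.dvd_prime_pow hp.out).mp hordp
  have hz : z = 1 := by
    rcases Nat.eq_zero_or_pos i with rfl | hipos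
    · rw [pow_zero] at hi; exact orderOf_eq_one_iff.mp hi
    · exfalso
      have hpd : p ∣ p * k - 1 := (dvd_pow_self p hipos.ne').trans (hi ▸ hord)
      rcases Nat.eq_zero_or_pos k with rfl | hkpos
      · -- then z = 1 from hk, contradicting i > 0 via orderOf
        rw [pow_zero] at hk
        have : orderOf z = 1 := by rw [← hk]; exact orderOf_one
        rw [this] at hi
        have h1lt : 1 < p ^ i := Nat.one_lt_pow hipos.ne' hp.out.one_lt
        rw [← hi] at h1lt
        exact absurd h1lt (lt_irrefl 1)
      · have h1 : p ∣ p * k := dvd_mul_right p k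
        have h2 : p ∣ p * k - (p * k - 1) := Nat.dvd_sub h1 hpd
        rw [Nat.sub_sub_self (Nat.one_le_iff_ne_zero.mpr (Nat.mul_ne_zero hp.out.ne_zero hkpos.ne'))] at h2
        exact hp.out.one_lt.ne' (Nat.dvd_one.mp h2)
  -- then every x is a power of 1
  apply hy
  obtain ⟨k', hk'⟩ := hgen y
  rw [hz, one_pow, one_pow] at hk'
  exact hk'.symm

/-- **Generator transfer**: `G` a finite cyclic `p`-group, `f : G → H` a homomorphism to a non-trivial commutative `p`-group; if
`f c` generates `H` then `c` generates `G` (write `c = g^a`; `p ∣ a` would make the `p`-th power `f(g^{a/p})^p` a generator of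
`H`; so `a` is prime to `#G` and `g` is a power of `c`). [folklore] -/
theorem forall_exists_pow_eq_of_map [Finite G] (hG : IsPGroup p G) (hcyc : IsCyclic G) {H : Type*} [CommGroup H]
    (hH : IsPGroup p H) {y : H} (hy : y ≠ 1) (f : G →* H) (c : G) (hc : ∀ x : H, ∃ k : ℕ, (f c) ^ k = x) :
    ∀ x : G, ∃ k : ℕ, c ^ k = x := by
  obtain ⟨g, hg⟩ := hcyc.exists_generator
  have hgpow : ∀ x : G, ∃ k : ℕ, g ^ k = x := fun x =>
    ((isOfFinOrder_of_finite g).mem_powers_iff_mem_zpowers).mpr (hg x)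
  obtain ⟨a, rfl⟩ := hgpow c
  -- p ∤ a
  have hpa : ¬ p ∣ a := by
    rintro ⟨a', rfl⟩
    refine not_generator_pow_prime hH hy (f (g ^ a')) fun x => ?_
    obtain ⟨k, hk⟩ := hc x
    exact ⟨k, by rw [← map_pow, ← pow_mul, ← hk, mul_comm]⟩
  -- a is coprime to ord g (a power of p)
  obtain ⟨j, hj⟩ := hG g
  obtain ⟨i, -, hi⟩ := (Nat.dvd_prime_pow hp.out).mp (orderOf_dvd_of_pow_eq_one hj)
  have hcop : a.Coprime (orderOf g) := by
    rw [hi]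
    exact (Nat.Coprime.pow_right i ((Nat.Prime.coprime_iff_not_dvd hp.out).mpr hpa).symm)
  obtain ⟨m, hm⟩ := exists_pow_eq_self_of_coprime hcop
  intro x
  obtain ⟨k, rfl⟩ := hgpow x
  exact ⟨m * k, by rw [pow_mul, hm]⟩

/-- The image of a generator generates the image: if `c` generates `G` and `f : G → H` is onto, `f c` generates `H`. [folklore] -/
theorem forall_exists_pow_eq_map {H : Type*} [CommGroup H] (f : G →* H) (hf : Function.Surjective f) (c : G)
    (hc : ∀ x : G, ∃ k : ℕ, c ^ k = x) : ∀ y : H, ∃ k : ℕ, (f c) ^ k = y := by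
  intro y
  obtain ⟨x, rfl⟩ := hf y
  obtain ⟨k, rfl⟩ := hc x
  exact ⟨k, by rw [map_pow]⟩

/-- A group generated by one element is cyclic. [folklore] -/
theorem isCyclic_of_forall_exists_pow_eq (c : G) (hc : ∀ x : G, ∃ k : ℕ, c ^ k = x) : IsCyclic G :=
  ⟨⟨c, fun x => by obtain ⟨k, rfl⟩ := hc x; exact ⟨k, zpow_natCast c k⟩⟩⟩

end Summit.BirchSwinnertonDyer.BirchSwinnertonDyer.Theorems.TowerSqrt
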